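import Literature.NumberTheory.LFunctions.ApproxFunctionalEquationGapMaster
import Literature.NumberTheory.LFunctions.ZetaTruncationUniformGap
import Summits.RiemannHypothesis.RiemannHypothesis.Theorems.EtaLeadingQuarterEtaLeadingSecondMomentSmallHeight

/-!
# The sharp eta trial vector at a zero: pre-stationary bound and the dual main term
(route EtaLeadingQuarter, item `EtaLeadingSecondMoment`, stmt-RiemannHypothesis-21791; BRIEF-L18-K1
regimes (Z2)/(Z3)) — RH enters only as "`s = 1/2 + it` is a zero of `ζ`".

For EVEN `M = 2K` and `T_M(s) = ∑_{m≤M} (−1)^m m^{−s} = 2^{1−s} ζ_K(s) − ζ_M(s)` (`altSum_eq`):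

* `norm_altSum_le_preStationary` — if `0 < t ≤ 2πK(1−δ)` (no stationary point beyond `M`), then
  `‖T_M(s)‖ ≤ (3 + 2/δ)(√2 K^{−1/2} + M^{−1/2})` (tree `norm_zeta_sub_sum_add_le_uniform_of_gap`
  at `K` and `M`; the main terms `2^{1−s}K^{1−s}`, `M^{1−s}` cancel exactly);
* `dualSum_odd_eq` — `2^{1−s} ∑_{ν≤[2y]} ν^{s−1} − ∑_{ν≤[y]} ν^{s−1} = 2^{1−s} ∑_{odd ν≤[2y]} ν^{s−1}`;
* `norm_altSum_add_dual_le` — in the stationary range with both lengths non-resonant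
  (`y = t/(2πM) ≥ 1`, `δ ≤ {y}, {2y} ≤ 1 − δ`):
  `‖T_M(s) + afeCoeff(s) 2^{1−s} ∑_{odd ν ≤ [2y]} ν^{s−1}‖ ≤ (√2 + 1)(4 + 2/δ + 9 + 4 log(2y+2)) K^{−1/2}`
  (tree `AFE.approxFunctionalEq_half_of_gap` at `a = K`, `a = M`).

Nothing here bears on the truth of RH.
-/

noncomputable section

open Complex MeasureTheory Set Filter Finset intervalIntegral
open scoped Real Topology ComplexConjugate

set_option linter.dupNamespace false  -- the mandated namespace repeats `RiemannHypothesis`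

namespace Summit.RiemannHypothesis.RiemannHypothesis.Theorems.EtaLeadingQuarter.EtaTrial

open Literature.NumberTheory.LFunctions Literature.NumberTheory.LFunctions.AFE

/-! ## Pre-stationary range -/

/-- `2^{1−s} K^{1−s} = (2K)^{1−s}`. [folklore] -/
theorem two_cpow_mul_cpow (s : ℂ) (K : ℕ) :
    (2 : ℂ) ^ (1 - s) * (K : ℂ) ^ (1 - s) = ((2 * K : ℕ) : ℂ) ^ (1 - s) := by
  have e : ((2 * K : ℕ) : ℂ) = ((2 : ℝ) : ℂ) * ((K : ℝ) : ℂ) := by push_cast; ring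
  rw [e, Complex.mul_cpow_ofReal_nonneg (by norm_num) (Nat.cast_nonneg K)]
  push_cast; ring

/-- `‖2^{1−s}‖ = √2 ≤ 3/2` for `Re s = 1/2`. [folklore] -/
theorem norm_two_cpow_le {s : ℂ} (hre : s.re = 1 / 2) : ‖(2 : ℂ) ^ (1 - s)‖ ≤ 3 / 2 := by
  rw [show (2 : ℂ) = ((2 : ℝ) : ℂ) by norm_num, Complex.norm_cpow_eq_rpow_re_of_pos (by norm_num),
    Complex.sub_re, Complex.one_re, hre, show (1 : ℝ) - 1 / 2 = 1 / 2 by norm_num, ← Real.sqrt_eq_rpow]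
  rw [show (3 / 2 : ℝ) = Real.sqrt ((3 / 2) ^ 2) by rw [Real.sqrt_sq]; norm_num]
  exact Real.sqrt_le_sqrt (by norm_num)

/-- **Pre-stationary range** (`M = 2K`, `0 < t ≤ 2πK(1−δ)`, `0 < δ ≤ 1`, `s = 1/2 + it` a zero of
`ζ`): `‖∑_{m≤M} (−1)^m m^{−s}‖ ≤ (3 + 2/δ)((3/2) K^{−1/2} + M^{−1/2})`. [folklore] -/
theorem norm_altSum_le_preStationary {s : ℂ} (hre : s.re = 1 / 2) (ht : 0 < s.im)
    (hζ : riemannZeta s = 0) {K : ℕ} (hK : 1 ≤ K) {δ : ℝ} (hδ : 0 < δ) (hδ1 : δ ≤ 1)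
    (htK : s.im ≤ 2 * π * K * (1 - δ)) :
    ‖∑ m ∈ Finset.Icc 1 (2 * K), (-1 : ℂ) ^ m * (m : ℂ) ^ (-s)‖ ≤
      (3 + 2 / δ) * (3 / 2 * (K : ℝ) ^ (-(1 / 2 : ℝ)) + ((2 * K : ℕ) : ℝ) ^ (-(1 / 2 : ℝ))) := by
  have hσ : 0 < s.re := by rw [hre]; norm_num
  have hσ2 : s.re ≤ 2 := by rw [hre]; norm_num
  have hM : 1 ≤ 2 * K := by omega
  have htM : s.im ≤ 2 * π * ((2 * K : ℕ) : ℝ) * (1 - δ) := by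
    have : 2 * π * (K : ℝ) * (1 - δ) ≤ 2 * π * ((2 * K : ℕ) : ℝ) * (1 - δ) := by
      push_cast; nlinarith [Real.pi_pos, (Nat.cast_nonneg K : (0:ℝ) ≤ K)]
    exact htK.trans this
  have hRM := norm_zeta_sub_sum_add_le_uniform_of_gap hσ hσ2 ht hM hδ hδ1 htM
  have hRK := norm_zeta_sub_sum_add_le_uniform_of_gap hσ hσ2 ht hK hδ hδ1 htK
  rw [hζ, zero_sub, hre] at hRM hRK
  rw [altSum_eq, show 2 * K / 2 = K by omega]
  have hs1 : s ≠ 1 := by intro h; rw [h] at ht; simp at ht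
  have h1s : (1 : ℂ) - s ≠ 0 := sub_ne_zero.2 (Ne.symm hs1)
  set ZM : ℂ := ∑ m ∈ Finset.Icc 1 (2 * K), (m : ℂ) ^ (-s)
  set ZK : ℂ := ∑ n ∈ Finset.Icc 1 K, (n : ℂ) ^ (-s)
  set RM : ℂ := -ZM + ((2 * K : ℕ) : ℂ) ^ (1 - s) / (1 - s) with hRMdef
  set RK : ℂ := -ZK + (K : ℂ) ^ (1 - s) / (1 - s) with hRKdef
  have key : (2 : ℂ) ^ (1 - s) * ZK - ZM = -((2 : ℂ) ^ (1 - s) * RK) + RM := by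
    have eK : ZK = (K : ℂ) ^ (1 - s) / (1 - s) - RK := by rw [hRKdef]; ring
    have eM : ZM = ((2 * K : ℕ) : ℂ) ^ (1 - s) / (1 - s) - RM := by rw [hRMdef]; ring
    rw [eK, eM, mul_sub, mul_div_assoc', two_cpow_mul_cpow]
    ring
  rw [key]
  have h2 := norm_two_cpow_le hre
  calc ‖-((2 : ℂ) ^ (1 - s) * RK) + RM‖ ≤ ‖(2 : ℂ) ^ (1 - s) * RK‖ + ‖RM‖ := by
        rw [← norm_neg ((2 : ℂ) ^ (1 - s) * RK)]; exact norm_add_le _ _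
    _ ≤ 3 / 2 * ((3 + 2 / δ) * (K : ℝ) ^ (-(1 / 2 : ℝ))) + (3 + 2 / δ) * ((2 * K : ℕ) : ℝ) ^ (-(1 / 2 : ℝ)) := by
        rw [norm_mul]
        have hπc : ((2 * K : ℕ) : ℂ) = (((2 * K : ℕ) : ℝ) : ℂ) := by push_cast; ring
        have hRM' : ‖RM‖ ≤ (3 + 2 / δ) * ((2 * K : ℕ) : ℝ) ^ (-(1 / 2 : ℝ)) := by
          simpa using hRM
        exact add_le_add (mul_le_mul h2 hRK (norm_nonneg _) (by norm_num)) hRM'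
    _ = _ := by ring

/-! ## The dual side: even/odd split -/

/-- `2^{1−s} ∑_{ν≤[2y]} ν^{s−1} − ∑_{μ≤[y]} μ^{s−1} = 2^{1−s} ∑_{odd ν≤[2y]} ν^{s−1}` (`y ≥ 0`):
the even `ν = 2μ ≤ [2y]` are exactly `μ ≤ [y]`, and `2^{1−s}(2μ)^{s−1} = μ^{s−1}`. [folklore] -/
theorem dualSum_odd_eq (s : ℂ) {y : ℝ} (hy : 0 ≤ y) :
    (2 : ℂ) ^ (1 - s) * ∑ ν ∈ Finset.Icc 1 ⌊2 * y⌋₊, (ν : ℂ) ^ (s - 1) -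
        ∑ μ ∈ Finset.Icc 1 ⌊y⌋₊, (μ : ℂ) ^ (s - 1) =
      (2 : ℂ) ^ (1 - s) * ∑ ν ∈ (Finset.Icc 1 ⌊2 * y⌋₊).filter (fun ν ↦ ¬Even ν), (ν : ℂ) ^ (s - 1) := by
  classical
  have himage : (Finset.Icc 1 ⌊2 * y⌋₊).filter (fun ν ↦ Even ν) =
      (Finset.Icc 1 ⌊y⌋₊).image (fun μ ↦ 2 * μ) := by
    ext ν
    simp only [Finset.mem_filter, Finset.mem_Icc, Finset.mem_image]
    constructor
    · rintro ⟨⟨h1, h2⟩, ⟨r, hr⟩⟩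
      refine ⟨r, ⟨by omega, ?_⟩, by omega⟩
      have h2' : (ν : ℝ) ≤ 2 * y := by
        have := Nat.floor_le (show 0 ≤ 2 * y by positivity); exact_mod_cast (le_trans (by exact_mod_cast h2) this)
      have h3 : (r : ℝ) + r = ν := by exact_mod_cast hr.symm
      exact Nat.le_floor (by linarith)
    · rintro ⟨μ, ⟨h1, h2⟩, rfl⟩
      refine ⟨⟨by omega, ?_⟩, ⟨μ, by ring⟩⟩
      have : (μ : ℝ) ≤ y := le_trans (by exact_mod_cast h2) (Nat.floor_le hy)
      exact Nat.le_floor (by push_cast; linarith)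
  have hinj : Set.InjOn (fun μ : ℕ ↦ 2 * μ) ↑(Finset.Icc 1 ⌊y⌋₊) := fun a _ b _ h ↦ by simpa using h
  have hE : ∑ ν ∈ (Finset.Icc 1 ⌊2 * y⌋₊).filter (fun ν ↦ Even ν), (ν : ℂ) ^ (s - 1) =
      (2 : ℂ) ^ (s - 1) * ∑ μ ∈ Finset.Icc 1 ⌊y⌋₊, (μ : ℂ) ^ (s - 1) := by
    rw [himage, Finset.sum_image hinj, Finset.mul_sum]
    refine Finset.sum_congr rfl fun μ _ ↦ ?_
    have e : ((2 * μ : ℕ) : ℂ) = ((2 : ℝ) : ℂ) * ((μ : ℝ) : ℂ) := by push_cast; ring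
    rw [e, Complex.mul_cpow_ofReal_nonneg (by norm_num) (Nat.cast_nonneg μ)]
    push_cast; ring
  have h22 : (2 : ℂ) ^ (1 - s) * (2 : ℂ) ^ (s - 1) = 1 := by
    rw [← Complex.cpow_add _ _ (by norm_num)]; simp
  rw [← Finset.sum_filter_add_sum_filter_not (Finset.Icc 1 ⌊2 * y⌋₊) (fun ν ↦ Even ν), hE,
    mul_add, ← mul_assoc, h22, one_mul]
  ring

/-! ## The stationary range with both lengths non-resonant -/

/-- **Dual main term** (`M = 2K`, `s = 1/2 + it` a zero, `y = t/(2πM) ≥ 1`, `δ ≤ {y} ≤ 1−δ`,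
`δ ≤ {2y} ≤ 1−δ`): `‖T_M(s) + afeCoeff(s)·2^{1−s} ∑_{odd ν≤[2y]} ν^{s−1}‖`
`≤ (3/2)(4K^{−1/2} + K^{−1/2}(2/δ + 9 + 4 log(2y+2))) + (4M^{−1/2} + M^{−1/2}(2/δ + 9 + 4 log(y+2)))`.
[folklore] -/
theorem norm_altSum_add_dual_le {t y δ : ℝ} {K : ℕ} (hK : 1 ≤ K) (hy : 1 ≤ y) (hδ : 0 < δ)
    (hty : t = 2 * π * ((2 * K : ℕ) : ℝ) * y) (hfr1 : δ ≤ Int.fract y) (hfr2 : Int.fract y ≤ 1 - δ)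
    (hfr1' : δ ≤ Int.fract (2 * y)) (hfr2' : Int.fract (2 * y) ≤ 1 - δ)
    (s : ℂ) (hs : s = 1 / 2 + t * I) (hζ : riemannZeta s = 0) :
    ‖∑ m ∈ Finset.Icc 1 (2 * K), (-1 : ℂ) ^ m * (m : ℂ) ^ (-s) +
        afeCoeff s * ((2 : ℂ) ^ (1 - s) *
          ∑ ν ∈ (Finset.Icc 1 ⌊2 * y⌋₊).filter (fun ν ↦ ¬Even ν), (ν : ℂ) ^ (s - 1))‖ ≤
      3 / 2 * (4 * (K : ℝ) ^ (-(1 / 2 : ℝ)) + (K : ℝ) ^ (-(1 / 2 : ℝ)) * (2 / δ + 9 + 4 * Real.log (2 * y + 2))) +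
        (4 * ((2 * K : ℕ) : ℝ) ^ (-(1 / 2 : ℝ)) +
          ((2 * K : ℕ) : ℝ) ^ (-(1 / 2 : ℝ)) * (2 / δ + 9 + 4 * Real.log (y + 2))) := by
  have hK0 : (0 : ℝ) < K := by exact_mod_cast hK
  have hM0 : (0 : ℝ) < ((2 * K : ℕ) : ℝ) := by positivity
  have hre : s.re = 1 / 2 := by rw [hs]; simp
  -- AFE at `a = M = 2K`, `y`, and at `a = K`, `2y`
  have hAM := approxFunctionalEq_half_of_gap (X := 2 * K) hM0 hy hδ hty hfr1 hfr2 le_rfl (by linarith)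
    (by omega) s hs
  have hty' : t = 2 * π * (K : ℝ) * (2 * y) := by rw [hty]; push_cast; ring
  have hAK := approxFunctionalEq_half_of_gap (X := K) hK0 (by linarith) hδ hty' hfr1' hfr2' le_rfl
    (by linarith) hK s hs
  rw [hζ, zero_sub] at hAM hAK
  -- the identity
  rw [altSum_eq, show 2 * K / 2 = K by omega, ← dualSum_odd_eq s (by linarith)]
  set ZM : ℂ := ∑ m ∈ Finset.Icc 1 (2 * K), (m : ℂ) ^ (-s)
  set ZK : ℂ := ∑ n ∈ Finset.Icc 1 K, (n : ℂ) ^ (-s)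
  set DM : ℂ := ∑ n ∈ Finset.Icc 1 ⌊y⌋₊, (n : ℂ) ^ (s - 1)
  set DK : ℂ := ∑ n ∈ Finset.Icc 1 ⌊2 * y⌋₊, (n : ℂ) ^ (s - 1)
  set C : ℂ := afeCoeff s
  have key : (2 : ℂ) ^ (1 - s) * ZK - ZM + C * ((2 : ℂ) ^ (1 - s) * DK - DM) =
      (2 : ℂ) ^ (1 - s) * (ZK + C * DK) - (ZM + C * DM) := by ring
  rw [key]
  have h2 := norm_two_cpow_le hre
  have eM : ‖ZM + C * DM‖ = ‖-ZM - C * DM‖ := by rw [← norm_neg]; congr 1; ring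
  have eK : ‖ZK + C * DK‖ = ‖-ZK - C * DK‖ := by rw [← norm_neg]; congr 1; ring
  have hA : ‖(2 : ℂ) ^ (1 - s) * (ZK + C * DK)‖ ≤
      3 / 2 * (4 * (K : ℝ) ^ (-(1 / 2 : ℝ)) + (K : ℝ) ^ (-(1 / 2 : ℝ)) * (2 / δ + 9 + 4 * Real.log (2 * y + 2))) := by
    rw [norm_mul, eK]
    exact mul_le_mul h2 hAK (norm_nonneg _) (by norm_num)
  have hB : ‖ZM + C * DM‖ ≤ 4 * ((2 * K : ℕ) : ℝ) ^ (-(1 / 2 : ℝ)) +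
      ((2 * K : ℕ) : ℝ) ^ (-(1 / 2 : ℝ)) * (2 / δ + 9 + 4 * Real.log (y + 2)) := by
    rw [eM]; exact hAM
  exact (norm_sub_le _ _).trans (add_le_add hA hB)

end Summit.RiemannHypothesis.RiemannHypothesis.Theorems.EtaLeadingQuarter.EtaTrial

end
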